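import Summits.NavierStokesRegularity.NavierStokesRegularity.Theorems.HeredityAtOne.Negative.CapStratumIntegrable
import Literature.Analysis.FluidPDE.ClassicalPolynomialDecayPersistence

/-!
# The capped stratum is EMPTY for divergence-free (curl-type) pushes — the decay input typed

Cell `ns-blowup`, seat `refuter-ns-palasek-19249-disprove-1` (g3; DISPROVER, route `PalasekTowerBreakdown`, item
stmt-NavierStokesRegularity-19249 `HeredityAtOne`). NEGATIVE-LANE lemmas (no positive Theses conclusion), sorry-free, no
named fact, no definition. Consumer of `Literature/Analysis/FluidPDE/ClassicalPolynomialDecayPersistence.lean`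
(lit g15, p499265) on the negative lane of the crux (`CapStratumIntegrable.lean`, fc-prover-3 g7, p492172).

`CapStratumIntegrable` proved: a registered stage whose `τ_k`-slice is INTEGRABLE is off the capped signed swirl-free
stratum `𝒮_k` (zero mean + positive hydrodynamic impulse), and left the decay input «which designs have integrable
slices» untyped. Here it is typed, hypothesis-free in the stage: every slice `u(t)`, `0 ≤ t ≤ τ_k`, of EVERY
registered stage (any rates, design, margins, viscosity `ν > 0`) whose design force is weakly divergence-free on
`[0, τ_k]` is integrable — persistence of the `(1+|x|)⁴` decay of Fefferman data (Lemarié-Rieusset 2016 §4.7/§4.9,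
Brandolese–Schonbek Thm. 2.9) for a BOUNDED classical solution, and a stage IS bounded (register ceiling `c₂ Y_k`),
of finite energy, from a Clay datum, under a Clay force. Hence:

* `stage_integrable_slice_of_divFree_push` — slices of a stage under a divergence-free push are `L¹`;
* `not_inCapStratum_of_divFree_push` — such a stage is NOT in `𝒮_k`;
* `capStratumEmptyAt_on_divFree_push` — the emptiness conjunct of item 19249's lossless split
  (`heredityAtOne_iff_offStratum_and_empty`) HOLDS on the sub-register of divergence-free pushes, design-free;
* `heredityAtOne_on_divFree_push_of_offStratum` — on that sub-register the item is implied by the repaired statement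
  `C′ = HeredityAtOffStratum 1` alone.

So the T2-r3 cap lever («a registered no-swirl host under the Gallay–Šverák cap») is EMPTY for every design that
pushes with a solenoidal force; what remains of `CapStratumEmptyAt 1` concerns designs whose force has a gradient /
compressive part (non-zero divergence), the only pushes that can load impulse into the slice. WHAT THIS IS NOT: not
NS evidence about any registered flow — no stage is constructed; 19249's verdict is unchanged.
[cite: LemarieRieusset2016, §4.7 Thm. 4.8 proof (pp. 57–59); §4.9 Thm. 4.11 (pp. 61–66)]
[cite: BrandoleseSchonbek2016, §2.9.2 Thm. 2.9 (p. 19)] [cite: Saffman1992, §3.2 eqs. (3.2.8), (3.2.13)]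
[cite: Palasek2026ElementaryModel, §4]
-/

noncomputable section

namespace Summit.NavierStokesRegularity.HeredityAtOneDivFreePush

open Set MeasureTheory Filter Topology Function
open scoped ENNReal NNReal
open Literature.Analysis.FluidPDE
open Summit.NavierStokesRegularity.FluidComputer
open Summit.NavierStokesRegularity.FluidComputer.PalasekTowerClayBridge
open Summit.NavierStokesRegularity.NavierStokesRegularity
open Summit.NavierStokesRegularity.HeredityAtOneNoSwirlCap
open Summit.NavierStokesRegularity.HeredityAtOneNoSwirlStratum
open Summit.NavierStokesRegularity.HeredityAtOneImpulse

/-! ## §1 Slices of a stage under a divergence-free push are integrable -/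

section AnyStage

variable {ν : ℝ} {R : TowerRates} {S : Schedule R} {m : Margins R} {k : ℕ}

/-- **`(1+|x|)⁴`-decay of every slice of a registered stage under a weakly divergence-free push** (`ν > 0`; any
rates, design, margins, level): the stage is a bounded (`≤ c₂ Y_k`) finite-energy classical solution from the Clay
datum `S.u₀` under the Clay force `S.f`, so Lemarié-Rieusset's persistence estimate applies on `[0, τ_k]`.
[cite: LemarieRieusset2016, §4.7 Thm. 4.8 proof (pp. 57–59); §4.9 Thm. 4.11 (pp. 61–66)]
[cite: BrandoleseSchonbek2016, §2.9.2 Thm. 2.9 (p. 19)] -/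
theorem stage_exists_pow_four_mul_norm_slice_le_of_divFree_push (hν : 0 < ν) (s : Stage ν R S m k)
    (hdiv : ∀ t ∈ Icc 0 (S.τ k), IsWeaklyDivFree (S.f t)) :
    ∃ C : ℝ, ∀ t ∈ Icc 0 (S.τ k), ∀ x, (1 + ‖x‖) ^ 4 * ‖s.u t x‖ ≤ C := by
  have hY : 0 < R.Y k := Real.rpow_pos_of_pos (R.N_pos k) _
  have hM : 0 < S.c₂ * R.Y k := mul_pos s.c₂_pos hY
  have hu₀ : HasRapidSpatialDecay (s.u 0) := by rw [s.initial]; exact S.datum_decay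
  exact s.classical.exists_forall_pow_four_mul_norm_le_of_clay_divFree hν S.force_smooth S.force_decay hdiv hu₀
    s.energy hM (s.ceiling k le_rfl)

/-- **Slices of a registered stage under a weakly divergence-free push are `L¹`** (`ν > 0`; any rates, design,
margins, level; every `t ∈ [0, τ_k]`). [cite: LemarieRieusset2016, §4.9 Thm. 4.11 (pp. 61–66)]
[cite: BrandoleseSchonbek2016, §2.9.2 Thm. 2.9 (p. 19)] -/
theorem stage_integrable_slice_of_divFree_push (hν : 0 < ν) (s : Stage ν R S m k)
    (hdiv : ∀ t ∈ Icc 0 (S.τ k), IsWeaklyDivFree (S.f t)) {t : ℝ} (ht : t ∈ Icc 0 (S.τ k)) :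
    Integrable (s.u t) := by
  have hY : 0 < R.Y k := Real.rpow_pos_of_pos (R.N_pos k) _
  have hM : 0 < S.c₂ * R.Y k := mul_pos s.c₂_pos hY
  have hu₀ : HasRapidSpatialDecay (s.u 0) := by rw [s.initial]; exact S.datum_decay
  exact s.classical.integrable_slice_of_clay_divFree hν S.force_smooth S.force_decay hdiv hu₀ s.energy hM
    (s.ceiling k le_rfl) ht

/-- The same for a pointwise divergence-free (smooth) push: `div (S.f t) = 0` for `t ∈ [0, τ_k]`. The force slices
are `C^∞` (`Schedule.force_smooth`), so they are weakly divergence-free (Evans, App. C.2).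
[cite: Evans2010, App. C.2 Thm. 2 with §5.2.1] [cite: LemarieRieusset2016, §4.9 Thm. 4.11 (pp. 61–66)] -/
theorem stage_integrable_slice_of_isDivFree_push (hν : 0 < ν) (s : Stage ν R S m k)
    (hdiv : ∀ t ∈ Icc 0 (S.τ k), VectorCalculus.IsDivFree (S.f t)) {t : ℝ} (ht : t ∈ Icc 0 (S.τ k)) :
    Integrable (s.u t) :=
  stage_integrable_slice_of_divFree_push hν s (fun τ hτ =>
    VectorCalculus.IsDivFree.isWeaklyDivFree_holds (hdiv τ hτ)
      (((S.force_smooth.isSmoothSpaceTimeOn_Icc (S.τ k)).contDiff_slice hτ).of_le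
        (by exact_mod_cast le_top))) ht

/-- **The readout slices `u(τ_j)`, `j ≤ k`, of a stage under a divergence-free push are `L¹`.**
[cite: LemarieRieusset2016, §4.9 Thm. 4.11 (pp. 61–66)] -/
theorem stage_integrable_readout_slice_of_divFree_push (hν : 0 < ν) (s : Stage ν R S m k)
    (hdiv : ∀ t ∈ Icc 0 (S.τ k), IsWeaklyDivFree (S.f t)) {j : ℕ} (hj : j ≤ k) :
    Integrable (s.u (S.τ j)) :=
  stage_integrable_slice_of_divFree_push hν s hdiv (τ_mem_Icc S hj)

/-- **No readout slice of a stage under a divergence-free push is signed swirl-free** (it is integrable, has zero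
mean, and a signed swirl-free integrable field with zero mean vanishes — but readout slices do not vanish).
[cite: Saffman1992, §3.2 eqs. (3.2.8), (3.2.13)] -/
theorem stage_not_signedNoSwirlSlice_of_divFree_push (hν : 0 < ν) (s : Stage ν R S m k)
    (hdiv : ∀ t ∈ Icc 0 (S.τ k), IsWeaklyDivFree (S.f t)) {j : ℕ} (hj : j ≤ k) (M : ℝ) :
    ¬ SignedNoSwirlSlice (s.u (S.τ j)) M :=
  not_signedNoSwirlSlice_of_integrable s hj (stage_integrable_readout_slice_of_divFree_push hν s hdiv hj) M

end AnyStage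

/-! ## §2 The stratum is empty for divergence-free pushes -/

variable {k : ℕ} {S : Schedule TowerRates.wide}

/-- **A registered stage under a weakly divergence-free push is OFF the capped stratum `𝒮_k`** (wide rates, route
margins, unit viscosity; no pins / rigidity / quietness / cap inequality used).
[cite: LemarieRieusset2016, §4.9 Thm. 4.11 (pp. 61–66)] [cite: Saffman1992, §3.2 eqs. (3.2.8), (3.2.13)] -/
theorem not_inCapStratum_of_divFree_push (s : Stage 1 TowerRates.wide S (Margins.routeG TowerRates.wide) k)
    (hdiv : ∀ t ∈ Icc 0 (S.τ k), IsWeaklyDivFree (S.f t)) : ¬ InCapStratum k S s :=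
  not_inCapStratum_of_integrable s (stage_integrable_readout_slice_of_divFree_push one_pos s hdiv le_rfl)

/-- Pointwise form: `div (S.f t) = 0` on `[0, τ_k]` ⇒ off the stratum. [cite: Evans2010, App. C.2 Thm. 2 with §5.2.1] -/
theorem not_inCapStratum_of_isDivFree_push (s : Stage 1 TowerRates.wide S (Margins.routeG TowerRates.wide) k)
    (hdiv : ∀ t ∈ Icc 0 (S.τ k), VectorCalculus.IsDivFree (S.f t)) : ¬ InCapStratum k S s :=
  not_inCapStratum_of_integrable s (stage_integrable_slice_of_isDivFree_push one_pos s hdiv (τ_mem_Icc S le_rfl))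

/-- **Members of the stratum are pushed compressively**: the design force of a stage in `𝒮_k` is NOT weakly
divergence-free at some time in `[0, τ_k]`. [cite: LemarieRieusset2016, §4.9 Thm. 4.11 (pp. 61–66)] -/
theorem exists_not_isWeaklyDivFree_push_of_inCapStratum
    {s : Stage 1 TowerRates.wide S (Margins.routeG TowerRates.wide) k} (hs : InCapStratum k S s) :
    ∃ t ∈ Icc 0 (S.τ k), ¬ IsWeaklyDivFree (S.f t) := by
  by_contra h
  push Not at h
  exact not_inCapStratum_of_divFree_push s h hs

/-- **`CapStratumEmptyAt k` ON THE SUB-REGISTER OF DIVERGENCE-FREE PUSHES** — the emptiness conjunct of item 19249's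
lossless split, restricted to designs whose force is weakly divergence-free on `[0, τ_k]`, HOLDS for every `k`,
design-free (the binder shape of `CapStratumEmptyAt` with one extra guard; pins / rigidity / quietness unused).
[cite: LemarieRieusset2016, §4.9 Thm. 4.11 (pp. 61–66)] [cite: Palasek2026ElementaryModel, §4] -/
theorem capStratumEmptyAt_on_divFree_push (k : ℕ) :
    ∀ S : Schedule TowerRates.wide, (∀ t ∈ Icc 0 (S.τ k), IsWeaklyDivFree (S.f t)) →
      S.Pins 8 (6 / 5) → S.Rigid → S.Quiet →
        ∀ s : Stage 1 TowerRates.wide S (Margins.routeG TowerRates.wide) k, ¬ InCapStratum k S s :=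
  fun _ hdiv _ _ _ s => not_inCapStratum_of_divFree_push s hdiv

/-- **The T2-r3 lever is EMPTY for solenoidal designs, at level 1 by name.** [cite: Palasek2026ElementaryModel, §4] -/
theorem capStratumEmptyAt_one_on_divFree_push :
    ∀ S : Schedule TowerRates.wide, (∀ t ∈ Icc 0 (S.τ 1), IsWeaklyDivFree (S.f t)) →
      S.Pins 8 (6 / 5) → S.Rigid → S.Quiet →
        ∀ s : Stage 1 TowerRates.wide S (Margins.routeG TowerRates.wide) 1, ¬ InCapStratum 1 S s :=
  capStratumEmptyAt_on_divFree_push 1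

/-! ## §3 Consequences for the item and its repair -/

/-- **On solenoidal designs the repaired statement `C′ = HeredityAtOffStratum 1` already IS the item**: every
registered level-1 stage of a pinned rigid quiet wide design with weakly divergence-free push on `[0, τ₁]` extends
to level 2, given `C′`. [cite: Palasek2026ElementaryModel, §4] -/
theorem heredityAtOne_on_divFree_push_of_offStratum (h : HeredityAtOffStratum 1)
    (hP : S.Pins 8 (6 / 5)) (hR : S.Rigid) (hQ : S.Quiet) (hdiv : ∀ t ∈ Icc 0 (S.τ 1), IsWeaklyDivFree (S.f t))
    (s : Stage 1 TowerRates.wide S (Margins.routeG TowerRates.wide) 1) :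
    ∃ s' : Stage 1 TowerRates.wide S (Margins.routeG TowerRates.wide) 2, s.Extends s' :=
  h S hP hR hQ s (not_inCapStratum_of_divFree_push s hdiv)

/-- **THE SPLIT OF ITEM 19249, SHARPENED ONCE MORE**: the emptiness conjunct may be restricted to registered level-1
stages of designs whose push is NOT weakly divergence-free at some time in `[0, τ₁]` (compressive pushes) — the
solenoidal ones are off the stratum by decay persistence + impulse. [cite: LemarieRieusset2016, §4.9 Thm. 4.11 (pp. 61–66)]
[cite: Saffman1992, §3.2 eqs. (3.2.8), (3.2.13)] [cite: Palasek2026ElementaryModel, §4] -/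
theorem heredityAtOne_iff_offStratum_and_empty_compressive :
    Theses.PalasekTowerBreakdown.HeredityAtOne ↔
      HeredityAtOffStratum 1 ∧
        ∀ S : Schedule TowerRates.wide, S.Pins 8 (6 / 5) → S.Rigid → S.Quiet →
          (∃ t ∈ Icc 0 (S.τ 1), ¬ IsWeaklyDivFree (S.f t)) →
            ∀ s : Stage 1 TowerRates.wide S (Margins.routeG TowerRates.wide) 1, ¬ InCapStratum 1 S s := by
  rw [heredityAtOne_iff_offStratum_and_empty]
  refine ⟨fun h => ⟨h.1, fun S hP hR hQ _ => h.2 S hP hR hQ⟩, fun h => ⟨h.1, fun S hP hR hQ s hs => ?_⟩⟩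
  exact h.2 S hP hR hQ (exists_not_isWeaklyDivFree_push_of_inCapStratum hs) s hs

/-- **Hence a refutation of item 19249 through the stratum needs a COMPRESSIVE push**: if `C′` holds, any
counterexample to `HeredityAtOne` is a pinned rigid quiet wide design whose force fails to be weakly divergence-free at
some time in `[0, τ₁]`, with a registered level-1 stage in `𝒮₁`. [cite: Palasek2026ElementaryModel, §4] -/
theorem exists_compressive_stratum_stage_of_not_heredityAtOne (hC : HeredityAtOffStratum 1)
    (h : ¬ Theses.PalasekTowerBreakdown.HeredityAtOne) :
    ∃ (S : Schedule TowerRates.wide) (s : Stage 1 TowerRates.wide S (Margins.routeG TowerRates.wide) 1),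
      S.Pins 8 (6 / 5) ∧ S.Rigid ∧ S.Quiet ∧ InCapStratum 1 S s ∧ ∃ t ∈ Icc 0 (S.τ 1), ¬ IsWeaklyDivFree (S.f t) := by
  by_contra hne
  push Not at hne
  refine h (heredityAtOne_iff_offStratum_and_empty_compressive.2 ⟨hC, fun S hP hR hQ hex s hs => ?_⟩)
  obtain ⟨t, ht, hnd⟩ := hex
  exact hnd (hne S s hP hR hQ hs t ht)

/-! ## §4 Sanity: the lazy design's push is solenoidal (it is zero) — and indeed its slice is unregistrable -/

/-- The lazy design (`Schedule.ofBox 0 0 …`, p484570) pushes with the zero force, which is weakly divergence-free;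
consistently, NO registered stage of the lazy design lies in the stratum (its lazy SLICE, which is capped signed
swirl-free and not integrable, is therefore not a slice of any registered stage of that design).
[cite: Palasek2026ElementaryModel, §4] -/
theorem not_inCapStratum_lazyDesign {k : ℕ}
    (s : Stage 1 TowerRates.wide HeredityAtOneLazySlice.lazyDesign (Margins.routeG TowerRates.wide) k) :
    ¬ InCapStratum k HeredityAtOneLazySlice.lazyDesign s := by
  refine not_inCapStratum_of_divFree_push s fun t _ => ?_
  have hf : HeredityAtOneLazySlice.lazyDesign.f t = 0 := by
    unfold HeredityAtOneLazySlice.lazyDesign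
    rw [Schedule.ofBox_f]
    rfl
  rw [hf]
  intro θ _
  simp

end Summit.NavierStokesRegularity.HeredityAtOneDivFreePush

end
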